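import Literature.NumberTheory.Automorphic.U3PrincipalSeriesJacquetFiltration
import HarnessLib

/-!
# N1 ★ `U3PrincipalSeriesJacquetFiltration` UNFOLDED as a theorem — the FULL `Iff`, including the `wχ`-stable line

Companion of ★ `U3PrincipalSeriesLettersUnfold` (p829690: N2∕N3∕N5∕N5′) and ★ `U3PrincipalSeriesJacquetFiltrationUnfold` (p829691: N1's
conjuncts 1–2 only).  N1 [Casselman1995, L. 7.1.1 (a)] is a `def … : Prop`; Lean abstracts the eight instance PROOFS in its value into private
aux constants `UnitaryGroup.U3PrincipalSeriesJacquetFiltration._proof_1 … _proof_8`, and the elaborator's `isDefEq` between the def's body and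
a theorem-world elaboration of the same text does not terminate within 1.6·10⁷ heartbeats ∕ 600 s at the ≈ 10⁷-node carrier type of
`cmPrincipalSeries L 3 v χ` (measured: `Iff.rfl`, the constructor bridge `(h : body) : … := h`, and the conjunct-3 projection all time out;
the kernel alone accepts the identification in ≈ 27 s).  META-FREE CURE (B-p10 (g21)'s device, adopted here with thanks): eight `rfl`-lemmas
`aux_proof_k : _proof_k = ‹the instance›` and `dsimp only [aux_proof_1, …, aux_proof_8, inferInstance]` VISITING PROOFS AND INSTANCE
ARGUMENTS (`set_option backward.dsimp.proofs true`, `instances := true`) rewrite the `_proof_k` leaves of the unfolded body into the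
instance terms a theorem-world statement carries; after that the two sides agree SYNTACTICALLY and `exact` is instant.
Result: `U3PrincipalSeriesJacquetFiltration_iff : U3PrincipalSeriesJacquetFiltration L ↔ <body verbatim>` — so N1's THIRD conjunct (the
`T`-stable line `ℓ` with `T` acting by `wχ` on `ℓ` and by `χ` modulo `ℓ`) is available in theorem-world to its consumers (the labelled-pair
junction S2, the N2 junction), and the in-house discharge of N1 (★-to-be `U3PrincipalSeriesJacquetFiltration_holds`) transports both ways.
Theorems only (8 private `rfl` lemmas + 1 theorem); no definition, no named fact, no instance.

## References
[Casselman1995] L. 7.1.1 (a) p. 67, Thm. 6.3.5 p. 59, Prop. 6.4.1 · [BernsteinZelevinsky1977] §2.12 Geometrical Lemma, Cor. 2.13 (c) · [Rogawski1990] §12.2 p. 173.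
-/

set_option autoImplicit false

noncomputable section

open MeasureTheory NumberField IsDedekindDomain
open scoped MatrixGroups NNReal

namespace Literature.NumberTheory.Automorphic

namespace UnitaryGroup

/-! ## §0 The eight aux constants of the `def` N1, identified with the instances (B-p10 (g21)'s lemmas, verbatim) -/

set_option linter.auxLemma false in
/-- `_proof_1` is the instance `SubsemiringClass (Subfield L) L`. [cite: Casselman1995, Lemma 7.1.1 (a) p. 67] -/
private theorem aux_proof_1 (L : Type) [Field L] :
    Eq (@U3PrincipalSeriesJacquetFiltration._proof_1 L _) inferInstance := rfl

set_option linter.auxLemma false in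
/-- `_proof_2` is the instance `Algebra.IsIntegral ℚ L`. [cite: Casselman1995, Lemma 7.1.1 (a) p. 67] -/
private theorem aux_proof_2 (L : Type) [Field L] [NumberField L] :
    Eq (@U3PrincipalSeriesJacquetFiltration._proof_2 L _ _) inferInstance := rfl

set_option linter.auxLemma false in
/-- `_proof_3` is the instance `IsDomain (𝓞 L⁺)`. [cite: Casselman1995, Lemma 7.1.1 (a) p. 67] -/
private theorem aux_proof_3 (L : Type) [Field L] :
    Eq (@U3PrincipalSeriesJacquetFiltration._proof_3 L _) inferInstance := rfl

set_option linter.auxLemma false in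
/-- `_proof_4` is the instance `Algebra.IsIntegral (𝓞 L⁺) (𝓞 L)`. [cite: Casselman1995, Lemma 7.1.1 (a) p. 67] -/
private theorem aux_proof_4 (L : Type) [Field L] :
    Eq (@U3PrincipalSeriesJacquetFiltration._proof_4 L _) inferInstance := rfl

set_option linter.auxLemma false in
/-- `_proof_5` is the instance `NumberField L⁺`. [cite: Casselman1995, Lemma 7.1.1 (a) p. 67] -/
private theorem aux_proof_5 (L : Type) [Field L] [NumberField L] :
    Eq (@U3PrincipalSeriesJacquetFiltration._proof_5 L _ _) inferInstance := rfl

set_option linter.auxLemma false in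
/-- `_proof_6` is the instance `SeparatelyContinuousMul (U(Φ₃)(L⁺_v))`. [cite: Casselman1995, Lemma 7.1.1 (a) p. 67] -/
private theorem aux_proof_6 (L : Type) [Field L] [NumberField L] [IsCMField L]
    (v : HeightOneSpectrum (𝓞 ↥(maximalRealSubfield L))) :
    Eq (@U3PrincipalSeriesJacquetFiltration._proof_6 L _ _ _ v) inferInstance := rfl

set_option linter.auxLemma false in
/-- `_proof_7` is the instance `IsTopologicalGroup (U(Φ₃)(L⁺_v))`. [cite: Casselman1995, Lemma 7.1.1 (a) p. 67] -/
private theorem aux_proof_7 (L : Type) [Field L] [NumberField L] [IsCMField L]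
    (v : HeightOneSpectrum (𝓞 ↥(maximalRealSubfield L))) :
    Eq (@U3PrincipalSeriesJacquetFiltration._proof_7 L _ _ _ v) inferInstance := rfl

set_option linter.auxLemma false in
/-- `_proof_8` is ★ `locallyCompactSpace_cmBorelU L 3 v`. [cite: Casselman1995, Lemma 7.1.1 (a) p. 67] -/
private theorem aux_proof_8 (L : Type) [Field L] [NumberField L] [IsCMField L]
    (v : HeightOneSpectrum (𝓞 ↥(maximalRealSubfield L))) :
    Eq (@U3PrincipalSeriesJacquetFiltration._proof_8 L _ _ _ v) (locallyCompactSpace_cmBorelU L 3 v) := rfl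


/-! ## §1 The bridge -/

variable (L : Type) [Field L] [NumberField L] [IsCMField L]

set_option backward.dsimp.proofs true in  -- `dsimp` must rewrite the `_proof_k` leaves, which are proofs in instance positions
set_option synthInstance.maxHeartbeats 400000 in  -- `Module ℂ` on the Jacquet module of the carrier (as in ★ N1's statement file)
set_option maxHeartbeats 4000000 in  -- the STATEMENT (smul ∕ membership on the coinvariants) + the two `dsimp` passes over ≈ 10⁷-node terms
/-- **N1 unfolded** (★ `U3PrincipalSeriesJacquetFiltration`, verbatim body on the right, INCLUDING the `wχ`-line).
[cite: Casselman1995, Lemma 7.1.1 (a) p. 67; Thm. 6.3.5 p. 59] [cite: BernsteinZelevinsky1977, §2.12 Geometrical Lemma, Cor. 2.13 (c)]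
[cite: Rogawski1990, §12.2 p. 173] -/
theorem U3PrincipalSeriesJacquetFiltration_iff :
    U3PrincipalSeriesJacquetFiltration L ↔
  ∀ (v : HeightOneSpectrum (𝓞 ↥(maximalRealSubfield L))),
    (∀ w : PlacesOver L v, IsCMField.complexConj L • w.1 = w.1) →
    ∀ (χ₁ : (LocalRing L v)ˣ →* ℂˣ) (χ₂ : ↥(normOneUnits (conjLocal L (IsCMField.complexConj L) v)) →* ℂˣ),
      Continuous (fun x => ((χ₁ x : ℂˣ) : ℂ)) → Continuous (fun x => ((χ₂ x : ℂˣ) : ℂ)) →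
    haveI := locallyCompactSpace_cmBorelU L 3 v
    FiniteDimensional ℂ ((cmBorelTriple L 3 v).restrict (cmPrincipalSeries L 3 v (cmTorusCharPair L v χ₁ χ₂))).Coinvariants ∧
    Module.finrank ℂ ((cmBorelTriple L 3 v).restrict (cmPrincipalSeries L 3 v (cmTorusCharPair L v χ₁ χ₂))).Coinvariants = 2 ∧
    ∃ ℓ : Submodule ℂ ((cmBorelTriple L 3 v).restrict (cmPrincipalSeries L 3 v (cmTorusCharPair L v χ₁ χ₂))).Coinvariants,
      Module.finrank ℂ ↥ℓ = 1 ∧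
      (∀ (m : ↥(cmBorelTriple L 3 v).M), ∀ x ∈ ℓ,
        (cmPrincipalSeries L 3 v (cmTorusCharPair L v χ₁ χ₂)).normalizedJacquet (cmBorelTriple L 3 v) m x =
          ((cmWeylTorusCharPair L v χ₁ χ₂ m : ℂˣ) : ℂ) • x) ∧
      (∀ (m : ↥(cmBorelTriple L 3 v).M) (x : ((cmBorelTriple L 3 v).restrict (cmPrincipalSeries L 3 v (cmTorusCharPair L v χ₁ χ₂))).Coinvariants),
        (cmPrincipalSeries L 3 v (cmTorusCharPair L v χ₁ χ₂)).normalizedJacquet (cmBorelTriple L 3 v) m x -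
          ((cmTorusCharPair L v χ₁ χ₂ m : ℂˣ) : ℂ) • x ∈ ℓ) := by
  constructor
  · intro h v hns χ₁ χ₂ h1c h2c
    have key := h v hns χ₁ χ₂ h1c h2c
    dsimp (config := { failIfUnchanged := false, instances := true }) only [aux_proof_1, aux_proof_2, aux_proof_3, aux_proof_4,
      aux_proof_5, aux_proof_6, aux_proof_7, aux_proof_8, inferInstance] at key ⊢
    exact key
  · intro h v hns χ₁ χ₂ h1c h2c
    have key := h v hns χ₁ χ₂ h1c h2c
    dsimp (config := { failIfUnchanged := false, instances := true }) only [aux_proof_1, aux_proof_2, aux_proof_3, aux_proof_4,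
      aux_proof_5, aux_proof_6, aux_proof_7, aux_proof_8, inferInstance] at key ⊢
    exact key

end UnitaryGroup

end Literature.NumberTheory.Automorphic

end
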